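import Summits.AnomalousDissipation.AnomalousDissipation.Theorems.SawtoothPulseCascadeK2InjectionCrossStream

/-!
# K2″ injection phase: the CROSS-STREAM energy of a linearised response along a shear is production-free
(route `AnomalousDissipation/SawtoothPulseCascade`, crux K2″ = stmt-AnomalousDissipation-19696
`K2LinearisedCascadeGrowth`, line `phase-cocycle`, stub A `stub_injectionPhase`; helper, `--supports`; sequel of
`…K2InjectionCrossStream`)

`…K2InjectionCrossStream.injectionPhase_of_crossStream` (p798971) reduces the registered stub A to an `L²` bound on the
CROSS-STREAM component `v = w₀` (the component along the coordinate `x₀` on which the vertical pulse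
`(0, rateV j t · U_j(x₀))` depends) of one neutral streamwise harmonic on the V half-slot.  This file records the first
structural fact about that variable, in the tree's torus calculus: along a shear `u` with NO cross-stream component
(`(∂ᵢu)ₖ = 0` for all `i`), the stretching term `((w·∇)u)ₖ` vanishes identically and the transport term
`∫ wₖ ((u·∇)w)ₖ = ∫ wₖ (u·∇)wₖ = 0` (`div u = 0`), so the cross-stream energy `∫ wₖ²` of a classical solution of
`∂ₜw + (u·∇)w + (w·∇)u = νΔw − ∇q` changes ONLY through viscosity and pressure:

* `convect_apply_eq_zero_of_partialDeriv_apply` — `((w·∇)u)(x)ₖ = Σᵢ wᵢ (∂ᵢu)ₖ = 0`;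
* `convect_apply_eq_convect_apply` — `((u·∇)w)(x)ₖ = ((u·∇)wₖ)(x)` (components commute with the derivative);
* `integral_mul_convect_apply_eq_zero` — `∫ wₖ ((u·∇)w)ₖ = 0` for `div u = 0`
  (`Torus.integral_inner_convect_self_right_eq_zero` for the scalar field `wₖ`);
* `hasDerivWithinAt_integral_crossStream_sq` — GENERIC (`𝕋^d`): `d/dt ∫ wₖ² = 2 ∫ wₖ (νΔw − ∇q)ₖ` within `[a, b]`;
* `hasDerivWithinAt_integral_crossStream_sq_of_mem_V` — the V half-slot of the cascade (`k = 0`):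
  `d/dt ∫ (w t x)₀² = 2 ∫ (w t x)₀ (νΔw − ∇q)(x)₀` — the Orr–Sommerfeld energy balance in velocity form, whose pressure is
  the "rapid" pressure `Δq = −2 rateV·U_j′ ∂₁w₀` (not derived here).

So any proof of the cross-stream bound `crossStreamBound_V` (workfile `Cruxes/K2LinearisedCascadeGrowth/Lines/
phase_cocycle_crossStream.lean`) is a statement about the pressure–cross-stream correlation `∫ w₀ ∂₀q` alone.
-/

-- `Summit.<Summit>.<Problem>` is the tree's mandated summit-side namespace (CONVENTIONS §2); for this
-- single-conjunct summit the two coincide, so the duplicate is deliberate (lakefile: off for `Summits`).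
set_option linter.dupNamespace false

noncomputable section

namespace Summit.AnomalousDissipation.AnomalousDissipation.Theorems.SawtoothPulseCascade.K2Classical

open Set MeasureTheory Filter
open scoped InnerProductSpace ContDiff Topology
open Literature.Analysis Literature.Analysis.FunctionSpaces Literature.Analysis.FluidPDE
open Literature.Analysis.FluidPDE.SawtoothCascade
open Literature.Analysis.FluidPDE.SawtoothCascade.CascadeParams

/-! ## §1 Components of the two convective terms -/

section Components

variable {d : Type*} [Fintype d] [DecidableEq d]

/-- **No stretching into a missing component.** If `u` is `C¹` and `(∂ᵢu(x))ₖ = 0` for every direction `i`, then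
`((w·∇)u)(x)ₖ = Σᵢ wᵢ(x) (∂ᵢu(x))ₖ = 0`. [cite: MajdaBertozziCUP2002, §3.1.1 Prop. 3.1 (the stretching term (w·∇)v)] -/
theorem convect_apply_eq_zero_of_partialDeriv_apply {u w : UnitAddTorus d → EuclideanSpace ℝ d}
    (hu : Torus.IsSmooth u) {x : UnitAddTorus d} {k : d} (hk : ∀ i, Torus.partialDeriv i u x k = 0) :
    Torus.convect w u x k = 0 := by
  have hconv : Torus.convect w u x = ∑ i, w x i • Torus.partialDeriv i u x :=
    Torus.fderiv_apply_eq_sum_partialDeriv (hu.isContDiff (by simp)) x (w x)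
  rw [hconv, WithLp.ofLp_sum, Finset.sum_apply]
  refine Finset.sum_eq_zero fun i _ => ?_
  rw [WithLp.ofLp_smul, Pi.smul_apply, hk i, smul_zero]

omit [DecidableEq d] in
/-- **Components commute with the convective derivative**: `((u·∇)w)(x)ₖ = ((u·∇)wₖ)(x)` for `C¹` `w`
(the coordinate projection is a continuous linear map). [folklore] -/
theorem convect_apply_eq_convect_apply {u w : UnitAddTorus d → EuclideanSpace ℝ d} (hw : Torus.IsSmooth w)
    (x : UnitAddTorus d) (k : d) :
    Torus.convect u w x k = Torus.convect u (fun y => w y k) x := by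
  show (Torus.fderiv w x (u x)) k = Torus.fderiv (fun y => w y k) x (u x)
  unfold Torus.fderiv
  have hd : DifferentiableAt ℝ (Torus.liftAt w x) 0 :=
    (((hw.isContDiff (n := 1) (by simp)).liftAt x).differentiable one_ne_zero).differentiableAt
  have hc := ((EuclideanSpace.proj k : EuclideanSpace ℝ d →L[ℝ] ℝ).hasFDerivAt.comp
    (0 : EuclideanSpace ℝ d) hd.hasFDerivAt)
  have hlift : Torus.liftAt (fun y => w y k) x =
      (EuclideanSpace.proj k : EuclideanSpace ℝ d →L[ℝ] ℝ) ∘ Torus.liftAt w x := by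
    funext v
    rfl
  rw [hlift, hc.fderiv]
  rfl

/-- **The transport term does no work on each component**: `∫ wₖ ((u·∇)w)ₖ = 0` for smooth `u`, `w` with
`div u = 0` (`Torus.integral_inner_convect_self_right_eq_zero` for the scalar field `wₖ`).
[cite: ConstantinFoiasNSE1988, Ch. 6 (6.13) (b(u,v,v) = 0)] -/
theorem integral_mul_convect_apply_eq_zero {u w : UnitAddTorus d → EuclideanSpace ℝ d} (hu : Torus.IsSmooth u)
    (hdiv : Torus.IsDivFree u) (hw : Torus.IsSmooth w) (k : d) :
    ∫ x, w x k * Torus.convect u w x k = 0 := by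
  have h0 := Torus.integral_inner_convect_self_right_eq_zero hu hdiv (hw.apply k)
  have h1 : (fun x => w x k * Torus.convect u w x k) =
      fun x => ⟪Torus.convect u (fun y => w y k) x, w x k⟫_ℝ := by
    funext x
    rw [convect_apply_eq_convect_apply hw x k, real_inner_eq_re_inner, RCLike.inner_apply, conj_trivial,
      RCLike.re_to_real]
  rw [h1]
  exact h0

end Components

/-! ## §2 The cross-stream energy identity along a shear without cross-stream component -/

section Identity

variable {d : Type*} [Fintype d] [DecidableEq d]
variable {a b ν : ℝ} {u w : ℝ → UnitAddTorus d → EuclideanSpace ℝ d} {q : ℝ → UnitAddTorus d → ℝ}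

/-- **Cross-stream energy identity.** Let `u` be jointly smooth on `[a, b] × 𝕋^d` (`a < b`) with divergence-free slices
and WITHOUT `k`-component to first order, `(∂ᵢu(t, x))ₖ = 0` for all `i` (a shear whose velocity is orthogonal to `eₖ`), and
let `(w, q)` be jointly smooth with `∂ₜw + (u·∇)w + (w·∇)u = νΔw − ∇q` pointwise (one-sided time derivative within
`[a, b]`).  Then `t ↦ ∫ wₖ(t)²` has the one-sided derivative `2 ∫ wₖ (νΔw − ∇q)ₖ` within `[a, b]`: the cross-stream energy
is PRODUCTION-FREE — the stretching term has no `k`-component and the transport term integrates to zero — and changes only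
through viscosity and the pressure gradient (the energy balance of the Orr–Sommerfeld variable).
[cite: ConstantinFoiasNSE1988, Ch. 14 (14.3)–(14.4) (the linearised equations and their energy equation); MajdaBertozziCUP2002, §3.1.1 Prop. 3.1] -/
theorem hasDerivWithinAt_integral_crossStream_sq
    (hu : Torus.IsSmoothSpaceTimeOn (Icc a b) u) (hudiv : ∀ t ∈ Icc a b, Torus.IsDivFree (u t))
    (hw : Torus.IsSmoothSpaceTimeOn (Icc a b) w) (hq : Torus.IsSmoothSpaceTimeOn (Icc a b) q)
    (hlin : ∀ t ∈ Icc a b, ∀ x, Torus.timeDerivWithin (Icc a b) w t x + Torus.convect (u t) (w t) x +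
      Torus.convect (w t) (u t) x = ν • Torus.laplacian (w t) x - Torus.gradient (q t) x)
    (hab : a < b) {k : d} (huk : ∀ t ∈ Icc a b, ∀ x, ∀ i, Torus.partialDeriv i (u t) x k = 0)
    {t : ℝ} (ht : t ∈ Icc a b) :
    HasDerivWithinAt (fun s => ∫ x, (w s x k) ^ 2)
      (2 * ∫ x, w t x k * (ν • Torus.laplacian (w t) x - Torus.gradient (q t) x) k) (Icc a b) t := by
  have hU : UniqueDiffOn ℝ (Icc a b) := uniqueDiffOn_Icc hab
  have hwt : Torus.IsSmooth (w t) := hw.isSmooth_slice ht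
  have hut : Torus.IsSmooth (u t) := hu.isSmooth_slice ht
  have hqt : Torus.IsSmooth (q t) := hq.isSmooth_slice ht
  -- differentiate under the integral sign
  have hφ : Torus.IsSmoothSpaceTimeOn (Icc a b) (fun s x => w s x k * w s x k) := (hw.apply k).mul (hw.apply k)
  have e : (fun s => ∫ x, (w s x k) ^ 2) = fun s => ∫ x, w s x k * w s x k := by
    funext s
    simp_rw [sq]
  rw [e]
  refine (hφ.hasDerivWithinAt_integral (convex_Icc a b) ht).congr_deriv ?_
  -- pointwise: `∂ₜ(wₖ²) = 2 wₖ (∂ₜw)ₖ`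
  have hcomp : ∀ x, HasDerivWithinAt (fun s => w s x k) (Torus.timeDerivWithin (Icc a b) w t x k) (Icc a b) t := by
    intro x
    have h := (EuclideanSpace.proj k : EuclideanSpace ℝ d →L[ℝ] ℝ).hasFDerivAt.comp_hasDerivWithinAt t
      (hw.hasDerivWithinAt_slice ht x)
    exact h
  have hpt : ∀ x, Torus.timeDerivWithin (Icc a b) (fun s x => w s x k * w s x k) t x =
      2 * (w t x k * Torus.timeDerivWithin (Icc a b) w t x k) := by
    intro x
    have h := ((hcomp x).mul (hcomp x)).derivWithin (hU t ht)
    show derivWithin (fun τ => w τ x k * w τ x k) (Icc a b) t = _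
    have e2 : (fun τ => w τ x k * w τ x k) = ((fun s => w s x k) * fun s => w s x k) := rfl
    rw [e2, h]
    ring
  -- the equation, component `k`, with the stretching term removed
  have heq : ∀ x, Torus.timeDerivWithin (Icc a b) w t x k =
      (ν • Torus.laplacian (w t) x - Torus.gradient (q t) x) k - Torus.convect (u t) (w t) x k := by
    intro x
    have h' : Torus.timeDerivWithin (Icc a b) w t x = (ν • Torus.laplacian (w t) x - Torus.gradient (q t) x) -
        Torus.convect (u t) (w t) x - Torus.convect (w t) (u t) x := by
      rw [← hlin t ht x]
      abel
    rw [h', WithLp.ofLp_sub, Pi.sub_apply, WithLp.ofLp_sub, Pi.sub_apply,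
      convect_apply_eq_zero_of_partialDeriv_apply hut (huk t ht x), sub_zero]
  -- integrability of the two remaining terms
  have hR : Torus.IsSmooth (fun x => (ν • Torus.laplacian (w t) x - Torus.gradient (q t) x) k) :=
    ((hwt.laplacian.smul ν).sub hqt.gradient).apply k
  have hs1 : Torus.IsSmooth (fun x => w t x k * (ν • Torus.laplacian (w t) x - Torus.gradient (q t) x) k) :=
    ContDiff.mul (hwt.apply k) hR
  have hs2 : Torus.IsSmooth (fun x => w t x k * Torus.convect (u t) (w t) x k) :=
    ContDiff.mul (hwt.apply k) ((hut.convect hwt).apply k)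
  have hi1 := hs1.integrable
  have hi2 := hs2.integrable
  simp_rw [hpt, heq, mul_sub]
  rw [integral_sub (hi1.const_mul 2) (hi2.const_mul 2), integral_const_mul, integral_const_mul,
    integral_mul_convect_apply_eq_zero hut (hudiv t ht) hwt k, mul_zero, sub_zero]

end Identity

/-! ## §3 The V half-slot of the cascade -/

/-- On a V half-slot the cascade field has no horizontal component to first order: `(∂ᵢū(t, x))₀ = 0` for `i = 0, 1`
(`ū = (0, rateV j t · U_j(x₀))`, `partialDeriv_field_of_mem_V`). [cite: ElgindiLissMattingly2025, §1 (u_α = V_α(x₁) e₂ on its half period)] -/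
theorem partialDeriv_field_apply_zero_of_mem_V (P : CascadeParams) {j : ℕ} {t : ℝ}
    (ht : t ∈ Icc (tStart j + tHalf j) (tStart (j + 1))) (x : UnitAddTorus (Fin 2)) :
    ∀ i : Fin 2, Torus.partialDeriv i (P.field t) x 0 = 0 := by
  refine Fin.forall_fin_two.2 ⟨?_, ?_⟩
  · rw [(P.partialDeriv_field_of_mem_V ht x).2]
    simp
  · rw [(P.partialDeriv_field_of_mem_V ht x).1]
    simp

/-- **Cross-stream energy identity on a V half-slot of the cascade.** On `[a, b] = [tStart j + tHalf j, tStart (j+1)]`,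
where the carrier is the vertical shear `(0, rateV j t · U_j(x₀))` (jointly smooth there), every smooth solution `(w, q)`
of the linearised Navier–Stokes equation satisfies `d/dt ∫ (w t x)₀² = 2 ∫ (w t x)₀ (νΔw − ∇q)(x)₀` within the slot:
the horizontal (= cross-stream) energy is production-free.
[cite: ConstantinFoiasNSE1988, Ch. 14 (14.3)–(14.4); ElgindiLissMattingly2025, §1 and Rmk. 1.4 (pulsed shear)] -/
theorem hasDerivWithinAt_integral_crossStream_sq_of_mem_V (P : CascadeParams) {j : ℕ} {ν : ℝ}
    (hu : Torus.IsSmoothSpaceTimeOn (Icc (tStart j + tHalf j) (tStart (j + 1))) P.field)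
    {w : ℝ → UnitAddTorus (Fin 2) → EuclideanSpace ℝ (Fin 2)} {q : ℝ → UnitAddTorus (Fin 2) → ℝ}
    (hw : Torus.IsSmoothSpaceTimeOn (Icc (tStart j + tHalf j) (tStart (j + 1))) w)
    (hq : Torus.IsSmoothSpaceTimeOn (Icc (tStart j + tHalf j) (tStart (j + 1))) q)
    (hlin : ∀ t ∈ Icc (tStart j + tHalf j) (tStart (j + 1)), ∀ x,
      Torus.timeDerivWithin (Icc (tStart j + tHalf j) (tStart (j + 1))) w t x +
        Torus.convect (P.field t) (w t) x + Torus.convect (w t) (P.field t) x =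
          ν • Torus.laplacian (w t) x - Torus.gradient (q t) x)
    {t : ℝ} (ht : t ∈ Icc (tStart j + tHalf j) (tStart (j + 1))) :
    HasDerivWithinAt (fun s => ∫ x, (w s x 0) ^ 2)
      (2 * ∫ x, w t x 0 * (ν • Torus.laplacian (w t) x - Torus.gradient (q t) x) 0)
      (Icc (tStart j + tHalf j) (tStart (j + 1))) t :=
  hasDerivWithinAt_integral_crossStream_sq hu (fun _ hs => P.isDivFree_field_of_mem_V hs) hw hq hlin
    (tMid_lt_tStart_succ j) (fun _ hs x i => partialDeriv_field_apply_zero_of_mem_V P hs x i) ht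

end Summit.AnomalousDissipation.AnomalousDissipation.Theorems.SawtoothPulseCascade.K2Classical

end
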